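import Literature.MathematicalPhysics.QuantumFieldTheory.Balaban1983to89.MatrixLog
import HarnessLib

/-!
# NE7LogCommutatorBound — LOGARITHMS OF ALMOST COMMUTING ELEMENTS ALMOST COMMUTE: `‖[log X, g]‖ ≤ ‖[X, g]‖ ∕ (1 − ‖X − 1‖)` for the series
# logarithm (B7 (21)) in a complete normed `ℂ`-algebra, and `‖[log X, log Y]‖ ≤ ‖[X, Y]‖ ∕ ((1 − ‖X − 1‖)(1 − ‖Y − 1‖))`

Cell `pub-balaban`, rung (B)+1 sub-cell t4, lineage `b2b-balaban-t4-ne7-p1`, generation 69 (CRUX PROVER NE7 #1); memo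
`t4/b2b-balaban-t4-ne7-p1-g68/HUNT-H12-OPEN-BY-MINIMISATION.md` §3bis ∕ §5(0) (PATH CHECK) and `…-g69/HUNT-H13-ROUTE-PI-TRANSPOSED.md` §6(5).  File F34.
WHY.  Along F21 ∕ F22's exponential data path `τ ↦ e^{τA}` the intermediate plaquettes are controlled by the commutators of the spread logarithms
`a_μ = log h_μ` of the Polyakov holonomies (H12 §3bis: «LOGARITHMS OF ALMOST COMMUTING UNITARIES … ALMOST COMMUTE … a count, not a theorem»).  THIS FILE is
the theorem for the series logarithm `MatrixLog.mlog` (domain `‖X − 1‖ < 1`): the commutator with a FIXED element passes through the logarithm at the cost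
`(1 − ‖X − 1‖)⁻¹`, by the termwise identity `[Aⁿ, g] = Σ_{i<n} Aⁱ[A, g]A^{n−1−i}` (`‖[Aⁿ, g]‖ ≤ n‖A‖^{n−1}‖[A, g]‖`) against the coefficients `1∕n` of (21).
WHAT ([folklore]; 0 def, 0 sorry; generic complete normed `ℂ`-algebra, so `Matrix n n ℂ` with any of the tree's norms).
§1 `norm_pow_comm_le` — `‖Aⁿg − gAⁿ‖ ≤ n·‖A‖^{n−1}·‖Ag − gA‖` (stated as `‖A^{n+1}g − gA^{n+1}‖ ≤ (n+1)‖A‖ⁿ‖Ag − gA‖`).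
§2 **`norm_mlog_comm_le`** — `‖X − 1‖ < 1 ⟹ ‖mlog X·g − g·mlog X‖ ≤ ‖X·g − g·X‖ ∕ (1 − ‖X − 1‖)`.
§3 **`norm_mlog_comm_mlog_le`** — `‖X − 1‖ < 1`, `‖Y − 1‖ < 1 ⟹ ‖mlog X·mlog Y − mlog Y·mlog X‖ ≤ ‖X·Y − Y·X‖ ∕ ((1 − ‖X − 1‖)(1 − ‖Y − 1‖))` (§2 twice).
HONEST FRAMING (page 1): elementary functional analysis; the PATH CHECK itself (smallness of the intermediate data of F22's path at every `N`) is NOT done here —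
this is its one non-bookkeeping input; NOT ONE-STEP, NOT NE7; spine 0∕9; finite T⁴ rung (B)+1 — NOT infinite volume, NOT mass gap, NOT Clay.  Continuum YM on
T⁴ ⇐ BetaPertH ∧ nine spine estimates (0/9 proved); BetaPertH ⇐ (D1) ∧ (D4) ∧ CAP+tail; G-an2-4 gates asym, D1 and NE2/3/4.
-/

set_option autoImplicit false

open scoped BigOperators
open NormedSpace

namespace Summit.QuantumFields.BalabanUV.T4Continuum.NE7LogCommutatorBound

open Literature.MathematicalPhysics.QuantumFieldTheory.Balaban1983to89
open Literature.Analysis.Complex (logSeriesCoeff logSeriesCoeff_zero)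
open MatrixLog (mlog hasSum_mlog)

noncomputable section

variable {𝔄 : Type*} [NormedRing 𝔄] [NormedAlgebra ℂ 𝔄]

/-! ## §1 The commutator of a power -/

omit [NormedAlgebra ℂ 𝔄] in
/-- The algebraic identity behind the bound: `A^{n+1}g − gA^{n+1} = A(Aⁿg − gAⁿ) + (Ag − gA)Aⁿ`. [folklore] -/
theorem pow_succ_comm_eq (A g : 𝔄) (n : ℕ) :
    A ^ (n + 1) * g - g * A ^ (n + 1) = A * (A ^ n * g - g * A ^ n) + (A * g - g * A) * A ^ n := by
  rw [pow_succ']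
  noncomm_ring

omit [NormedAlgebra ℂ 𝔄] in
/-- **`‖A^{n+1}g − gA^{n+1}‖ ≤ (n+1)·‖A‖ⁿ·‖Ag − gA‖`** (induction on `n` over `pow_succ_comm_eq`). [folklore] -/
theorem norm_pow_comm_le (A g : 𝔄) : ∀ n : ℕ, ‖A ^ (n + 1) * g - g * A ^ (n + 1)‖ ≤ (n + 1) * ‖A‖ ^ n * ‖A * g - g * A‖
  | 0 => by simp
  | n + 1 => by
      have ih := norm_pow_comm_le A g n
      rw [pow_succ_comm_eq A g (n + 1)]
      have h1 : ‖A * (A ^ (n + 1) * g - g * A ^ (n + 1))‖ ≤ ‖A‖ * ((n + 1) * ‖A‖ ^ n * ‖A * g - g * A‖) :=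
        (norm_mul_le _ _).trans (mul_le_mul_of_nonneg_left ih (norm_nonneg _))
      have h2 : ‖(A * g - g * A) * A ^ (n + 1)‖ ≤ ‖A * g - g * A‖ * ‖A‖ ^ (n + 1) :=
        (norm_mul_le _ _).trans (mul_le_mul_of_nonneg_left (norm_pow_le' A (Nat.succ_pos n)) (norm_nonneg _))
      have e : ‖A‖ * ((n + 1) * ‖A‖ ^ n * ‖A * g - g * A‖) + ‖A * g - g * A‖ * ‖A‖ ^ (n + 1)
          = ((n : ℝ) + 1 + 1) * ‖A‖ ^ (n + 1) * ‖A * g - g * A‖ := by ring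
      calc ‖A * (A ^ (n + 1) * g - g * A ^ (n + 1)) + (A * g - g * A) * A ^ (n + 1)‖
          ≤ ‖A * (A ^ (n + 1) * g - g * A ^ (n + 1))‖ + ‖(A * g - g * A) * A ^ (n + 1)‖ := norm_add_le _ _
        _ ≤ ‖A‖ * ((n + 1) * ‖A‖ ^ n * ‖A * g - g * A‖) + ‖A * g - g * A‖ * ‖A‖ ^ (n + 1) := add_le_add h1 h2
        _ = ((n : ℝ) + 1 + 1) * ‖A‖ ^ (n + 1) * ‖A * g - g * A‖ := e
        _ = (((n + 1 : ℕ) : ℝ) + 1) * ‖A‖ ^ (n + 1) * ‖A * g - g * A‖ := by push_cast; ring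

/-! ## §2 The commutator passes through the series logarithm -/

variable [CompleteSpace 𝔄]

/-- **LOGARITHMS OF ALMOST COMMUTING ELEMENTS ALMOST COMMUTE WITH THE OTHER FACTOR**: for `‖X − 1‖ < 1` and any `g`,
`‖(log X)g − g(log X)‖ ≤ ‖Xg − gX‖ ∕ (1 − ‖X − 1‖)` (`log` = the series (21), `MatrixLog.mlog`). [folklore] -/
theorem norm_mlog_comm_le {X : 𝔄} (hX : ‖X - 1‖ < 1) (g : 𝔄) :
    ‖mlog X * g - g * mlog X‖ ≤ ‖X * g - g * X‖ / (1 - ‖X - 1‖) := by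
  set A : 𝔄 := X - 1 with hA
  have hAg : A * g - g * A = X * g - g * X := by rw [hA]; noncomm_ring
  -- the termwise series of the commutator
  have hS := hasSum_mlog hX
  have hT : HasSum (fun n : ℕ => logSeriesCoeff n • (A ^ n * g - g * A ^ n)) (mlog X * g - g * mlog X) := by
    have h1 := hS.mul_right g
    have h2 := hS.mul_left g
    have h3 := h1.sub h2
    refine h3.congr_fun fun n => ?_
    show logSeriesCoeff n • (A ^ n * g - g * A ^ n) = logSeriesCoeff n • (X - 1) ^ n * g - g * logSeriesCoeff n • (X - 1) ^ n
    rw [hA, smul_sub, smul_mul_assoc, mul_smul_comm]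
  -- drop the vanishing `n = 0` term
  have hT' : HasSum (fun n : ℕ => logSeriesCoeff (n + 1) • (A ^ (n + 1) * g - g * A ^ (n + 1))) (mlog X * g - g * mlog X) := by
    have h := (hasSum_nat_add_iff' (f := fun n : ℕ => logSeriesCoeff n • (A ^ n * g - g * A ^ n)) 1).mpr hT
    simpa using h
  -- the geometric majorant
  have hA0 : 0 ≤ ‖A‖ := norm_nonneg _
  have hA1 : ‖A‖ < 1 := hX
  have hG : HasSum (fun n : ℕ => ‖A‖ ^ n * ‖A * g - g * A‖) ((1 - ‖A‖)⁻¹ * ‖A * g - g * A‖) :=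
    (hasSum_geometric_of_lt_one hA0 hA1).mul_right _
  have hb : ∀ n : ℕ, ‖logSeriesCoeff (n + 1) • (A ^ (n + 1) * g - g * A ^ (n + 1))‖ ≤ ‖A‖ ^ n * ‖A * g - g * A‖ := by
    intro n
    rw [norm_smul, MatrixLog.norm_logSeriesCoeff_succ]
    have h := norm_pow_comm_le A g n
    have hn : (0 : ℝ) < n + 1 := by positivity
    calc 1 / ((n : ℝ) + 1) * ‖A ^ (n + 1) * g - g * A ^ (n + 1)‖
        ≤ 1 / ((n : ℝ) + 1) * ((n + 1) * ‖A‖ ^ n * ‖A * g - g * A‖) := mul_le_mul_of_nonneg_left h (by positivity)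
      _ = ‖A‖ ^ n * ‖A * g - g * A‖ := by field_simp
  have h := HasSum.norm_le_of_bounded hT' hG hb
  rw [hAg] at h
  rw [div_eq_inv_mul]
  exact h

/-! ## §3 Two logarithms -/

omit [NormedAlgebra ℂ 𝔄] [CompleteSpace 𝔄] in
/-- `‖gX − Xg‖ = ‖Xg − gX‖`. [folklore] -/
theorem norm_comm_symm (X g : 𝔄) : ‖g * X - X * g‖ = ‖X * g - g * X‖ := by
  rw [← norm_neg]; congr 1; noncomm_ring

/-- **`‖[log X, log Y]‖ ≤ ‖[X, Y]‖ ∕ ((1 − ‖X − 1‖)(1 − ‖Y − 1‖))`** for `‖X − 1‖, ‖Y − 1‖ < 1` — §2 applied to `(X, g := log Y)` and then to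
`(Y, g := X)`. [folklore] -/
theorem norm_mlog_comm_mlog_le {X Y : 𝔄} (hX : ‖X - 1‖ < 1) (hY : ‖Y - 1‖ < 1) :
    ‖mlog X * mlog Y - mlog Y * mlog X‖ ≤ ‖X * Y - Y * X‖ / ((1 - ‖X - 1‖) * (1 - ‖Y - 1‖)) := by
  have h1 := norm_mlog_comm_le hX (mlog Y)
  have h2 := norm_mlog_comm_le hY X
  rw [norm_comm_symm X (mlog Y), norm_comm_symm X Y] at h2
  have hx : 0 < 1 - ‖X - 1‖ := by linarith
  have h3 : ‖X * mlog Y - mlog Y * X‖ / (1 - ‖X - 1‖) ≤ (‖X * Y - Y * X‖ / (1 - ‖Y - 1‖)) / (1 - ‖X - 1‖) :=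
    div_le_div_of_nonneg_right h2 hx.le
  calc ‖mlog X * mlog Y - mlog Y * mlog X‖ ≤ ‖X * mlog Y - mlog Y * X‖ / (1 - ‖X - 1‖) := h1
    _ ≤ (‖X * Y - Y * X‖ / (1 - ‖Y - 1‖)) / (1 - ‖X - 1‖) := h3
    _ = ‖X * Y - Y * X‖ / ((1 - ‖X - 1‖) * (1 - ‖Y - 1‖)) := by rw [div_div, mul_comm]

end

end Summit.QuantumFields.BalabanUV.T4Continuum.NE7LogCommutatorBound
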